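/-
Origin: expansion seat `prover-pub-hodgecm-own-mu-0`, handover #MU3 2026-08-21T04:34:36Z md5 b75f023dd57f (185 l.; NEW; imports HodgeCM.Model.ArchKTypeOfCentralWeightR234 (#CA73 landed RUN 71) + HodgeCM.Model.AdelicThetaDistributionBridgeTwist (#1256 landed); 12 theorems; NAMES: ArchSideTerm.eta_mk_one_eq_of_chiW · SInstance.adelicCharZero_pin_eq_of_mu · SInstance.lineCharV_zero_pin_eq_of_mu; drop-alone) (`HOME/pub-hodgecm-own-mu/stage72/HodgeCM/Model/ArchMuDecoupling.lean`, md5 b75f023dd57f, 185 lines);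
landed by the second packager p2 gen 18 (p2-g18) in gate run 72 as `HodgeCM/Model/ArchMuDecoupling.lean` (verbatim).
-/
/-
Origin: NAMED SINGLE-OWNER PROVER `prover-pub-hodgecm-own-mu-0` (unit pub-hodgecm-own-mu; BINDER-OWNERS row 6 `μ`), 2026-08-21.
Target in PKG: `HodgeCM/Model/ArchMuDecoupling.lean` (NEW additive drop-alone leaf over carch-1's RUN-71 #CA72 ∕ #CA73
`Model/ArchKTypeOfCentralWeightR2` ∕ `…R234` and sinst-1's #1256 `Model/AdelicThetaDistributionBridgeTwist`; nothing imports it).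
KERNEL ONLY: theorems; 0 defs, 0 records, nothing cited, 0 `def … : Prop`, no Literature path, MODEL-N ±0; E untouched.
Nothing here is a claim of the manuscripts under adjudication.
-/
import Summits.HodgeConjecture.HodgeCM.Model.ArchKTypeOfCentralWeightR234_2
import Summits.HodgeConjecture.HodgeCM.Model.AdelicThetaDistributionBridgeTwist

/-!
# Row 6 ↔ row 9 DECOUPLING: the junction's `V`-side data do not read the `W`-side character `χ_W`

E's row-6 table `μ` reaches the R2-J pin in exactly one place: the W pin's twist
`η := EtaChi.η χV χW` with `χW := SInstance.χWR hGR hGR₀ hGR₁ μ = χOfType (μ c 0 − slotTypeVec 0)` (the slot-0 normalisation,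
`Model/ThetaAdelicSideReadOff`).  The (J-Liu-Θ) junction behind row 9 reads the pin through the `V`-CHARACTERS of the twisted slot
splittings — carch-1's `lineCharV_k … (etaT_k … η ν)` (#CA72/#CA73) and sinst-1's slot big characters `bigCharOfV (adelicChar_k …)`
(#1256) — e.g. binder-2's index hypothesis `hμ : μ₀⟦a_k⟧ = charArchType (centerCharInf V (adelicChar_k …)) + centralTypeOf V a_k hGR_k`
and theta-3's `centralTypeOfTwist`.  This leaf records, as kernel identities, that NONE of these read `χ_W`:

* §1 (generic families `χV χW χW'`, any `ν`): `EtaChi.η χV χW V c (v, 1) = EtaChi.η χV χW' V c (v, 1)` (`eta_mk_one_eq_of_chiW`);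
  hence `lineCharV_zero ∕ two … (etaT₀∕₂ … (EtaChi.η χV χW V c) ν)` do not depend on `χW` (`lineCharV_zero∕two_etaT_eq_of_chiW`),
  `lineCharV_one ∕ three … (etaT₁∕₃ … η ν) = ν` do not depend on `η` at all (carch `lineCharV_one_etaT₁`, `lineCharV_three_etaT₃`),
  and sinst-1's `adelicCharZero … (EtaChi.η χV χW V c)` does not depend on `χW` (`adelicCharZero_eq_of_chiW`);
* §2 (AT THE PIN OF RECORD, two row-6 tables `μ μ'`): the four `V`-characters
  `lineCharV_k V c.D … (etaT_k V c.D (EtaChi.η (χVR …) (χWR … μ) V c) (νR ∕ ν'R …))`, `k = 0,1,2,3`, and `adelicCharZero` at that `η`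
  COINCIDE for `μ` and `μ'` (`lineCharV_zero∕one∕two∕three_pin_eq_of_mu`, `adelicCharZero_pin_eq_of_mu`).

Consequence (prose, for BINDER-OWNERS rows 6∕9): every junction quantity built from these characters — binder-2's `hμ` right-hand side,
theta-3's `centralTypeOf ∕ centralTypeOfTwist`, carch's (CC_k) — takes the same value for every row-6 table; the only junction identity
that mentions a slot WEIGHT, (Hw_k′), is carch's theorem for generic `μ` (`archWeight_mul_lineCharV_k_eq_torusScalar_ROGT'C`).  So the
instantiation of row 6 at any closed form (own-mu «ARM»: `μ := muSharp₂₃ @muSlotZero`) moves no content into row 9.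
-/

set_option autoImplicit false

noncomputable section

open scoped Matrix
open Literature.NumberTheory.Automorphic Literature.NumberTheory.Weil1964
open Literature.NumberTheory.GelbartRogawski1991 Literature.NumberTheory.GelbartRogawski1991.UnitaryDualPair
open HodgeCM.Adelic HodgeCM.PerL34

/-! ## §1 generic character families -/

namespace HodgeCM.Model.ArchSideTerm

section Generic

variable {L : CMField} {ι₁ : L →+* ℂ} (V : HermSpace3 L ι₁) (c : SeesawCtx L)
  (hGR : (cmSplittingDatum (L : Type) finProdFinEquiv (frameD V) (frameD_real V) (frameD_ne V) (dW c.D) (dW_real c.D)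
    (dW_ne c.D)).CompatibleSplitting)
  (hGR₀ : (cmSplittingDatum (L : Type) (e₁) (frameD V) (frameD_real V) (frameD_ne V) (lineVec (L : Type) (dW c.D 0))
    (fun _ => dW_real c.D 0) (fun _ => dW_ne c.D 0)).CompatibleSplitting)
  (hGR₁ : (cmSplittingDatum (L : Type) (e₁) (frameD V) (frameD_real V) (frameD_ne V) (lineVec (L : Type) (dW c.D 1))
    (fun _ => dW_real c.D 1) (fun _ => dW_ne c.D 1)).CompatibleSplitting)
  (hGR₂ : (cmSplittingDatum (L : Type) (e₁) (frameD V) (frameD_real V) (frameD_ne V) (lineVec (L : Type) (dW' c.D 0))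
    (fun _ => dW'_real c.D 0) (fun _ => dW'_ne c.D 0)).CompatibleSplitting)
  (hGR₃ : (cmSplittingDatum (L : Type) (e₁) (frameD V) (frameD_real V) (frameD_ne V) (lineVec (L : Type) (dW' c.D 1))
    (fun _ => dW'_real c.D 1) (fun _ => dW'_ne c.D 1)).CompatibleSplitting)
  (χV χW χW' : ∀ {L : CMField} {ι₁ : L →+* ℂ} (_V : HermSpace3 L ι₁) (_c : SeesawCtx L),
    ContinuousMonoidHom (Literature.NumberTheory.Automorphic.relNormOneIdeles (↥(NumberField.maximalRealSubfield (L : Type))) (L : Type) ⧸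
      Literature.NumberTheory.Automorphic.relNormOneRat (↥(NumberField.maximalRealSubfield (L : Type))) (L : Type)) Circle)
  (ν ν' : CMAdelic (L : Type) (frameD V) →* ℂˣ)

/-- **the W pin's twist at `(v, 1)` does not read `χ_W`**: `η_{χV,χW}(v, 1) = χV(det v) = η_{χV,χW'}(v, 1)`. -/
theorem eta_mk_one_eq_of_chiW (v : CMAdelic (L : Type) (frameD V)) :
    EtaChi.η @χV @χW V c (v, 1) = EtaChi.η @χV @χW' V c (v, 1) := by
  rw [EtaChi.η_apply, EtaChi.η_apply]
  simp only [map_one, mul_one]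

/-- `η₀ (v, 1) = η (v, 1)` (the plane-torus inclusion at `u = 1`). -/
theorem eta₀_apply_mk_one (η : CMAdelic (L : Type) (frameD V) × CMAdelic (L : Type) (dW c.D) →* ℂˣ)
    (v : CMAdelic (L : Type) (frameD V)) : eta₀ V c.D η (v, 1) = η (v, 1) := by
  show η (((MonoidHom.id _).prodMap (cmPlaneTorusInl (L : Type) (dW c.D))) (v, 1)) = η (v, 1)
  rw [MonoidHom.prodMap_def]
  simp only [MonoidHom.prod_apply, MonoidHom.coe_comp, Function.comp_apply, MonoidHom.coe_fst, MonoidHom.coe_snd,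
    MonoidHom.id_apply, map_one]

/-- **slot 0**: carch's `V`-character of the `η`-twisted slot-0 split does not read `χ_W`. -/
theorem lineCharV_zero_etaT_eq_of_chiW :
    lineCharV_zero V c.D hGR hGR₀ hGR₁ (etaT₀ V c.D (EtaChi.η @χV @χW V c) ν) =
      lineCharV_zero V c.D hGR hGR₀ hGR₁ (etaT₀ V c.D (EtaChi.η @χV @χW' V c) ν) := by
  ext v : 1
  rw [lineCharV_zero_etaT₀_apply, lineCharV_zero_etaT₀_apply, eta_mk_one_eq_of_chiW V c @χV @χW @χW']

/-- **slot 1**: the `V`-character is `ν`, whatever `η` is (carch `lineCharV_one_etaT₁`). -/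
theorem lineCharV_one_etaT_eq_of_chiW :
    lineCharV_one V c.D hGR hGR₀ hGR₁ (etaT₁ V c.D (EtaChi.η @χV @χW V c) ν) =
      lineCharV_one V c.D hGR hGR₀ hGR₁ (etaT₁ V c.D (EtaChi.η @χV @χW' V c) ν) := by
  simp only [lineCharV_one_etaT₁]

/-- **slot 2** (conjugated plane): does not read `χ_W`. -/
theorem lineCharV_two_etaT_eq_of_chiW :
    lineCharV_two V c.D hGR hGR₂ hGR₃ (etaT₂ V c.D (EtaChi.η @χV @χW V c) ν') =
      lineCharV_two V c.D hGR hGR₂ hGR₃ (etaT₂ V c.D (EtaChi.η @χV @χW' V c) ν') := by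
  ext v : 1
  rw [lineCharV_two_etaT₂_apply, lineCharV_two_etaT₂_apply, eta_mk_one_eq_of_chiW V c @χV @χW @χW']

/-- **slot 3**: the `V`-character is `ν'`, whatever `η` is (carch `lineCharV_three_etaT₃`). -/
theorem lineCharV_three_etaT_eq_of_chiW :
    lineCharV_three V c.D hGR hGR₂ hGR₃ (etaT₃ V c.D (EtaChi.η @χV @χW V c) ν') =
      lineCharV_three V c.D hGR hGR₂ hGR₃ (etaT₃ V c.D (EtaChi.η @χV @χW' V c) ν') := by
  simp only [lineCharV_three_etaT₃]

/-- **sinst-1's slot-0 `V`-character `adelicCharZero` (the `V`-part of the big character `ĉ₀`) does not read `χ_W`.** -/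
theorem adelicCharZero_eq_of_chiW :
    ThetaAdelicSide.adelicCharZero V c hGR hGR₀ hGR₁ (EtaChi.η @χV @χW V c) =
      ThetaAdelicSide.adelicCharZero V c hGR hGR₀ hGR₁ (EtaChi.η @χV @χW' V c) := by
  ext v : 1
  rw [ThetaAdelicSide.adelicCharZero_apply, ThetaAdelicSide.adelicCharZero_apply, eta₀_apply_mk_one, eta₀_apply_mk_one,
    eta_mk_one_eq_of_chiW V c @χV @χW @χW']

end Generic

end HodgeCM.Model.ArchSideTerm

/-! ## §2 at the pin of record: two row-6 tables give the same `V`-characters -/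

namespace HodgeCM.Model.SInstance

open HodgeCM.Model.ArchSideTerm

variable
  (hGR : ∀ {L : CMField} {ι₁ : L →+* ℂ} (V : HermSpace3 L ι₁) (c : SeesawCtx L),
    (cmSplittingDatum (L : Type) finProdFinEquiv (frameD V) (frameD_real V) (frameD_ne V) (dW c.D) (dW_real c.D)
      (dW_ne c.D)).CompatibleSplitting)
  (hGR₀ : ∀ {L : CMField} {ι₁ : L →+* ℂ} (V : HermSpace3 L ι₁) (c : SeesawCtx L),
    (cmSplittingDatum (L : Type) (e₁) (frameD V) (frameD_real V) (frameD_ne V) (lineVec (L : Type) (dW c.D 0))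
      (fun _ => dW_real c.D 0) (fun _ => dW_ne c.D 0)).CompatibleSplitting)
  (hGR₁ : ∀ {L : CMField} {ι₁ : L →+* ℂ} (V : HermSpace3 L ι₁) (c : SeesawCtx L),
    (cmSplittingDatum (L : Type) (e₁) (frameD V) (frameD_real V) (frameD_ne V) (lineVec (L : Type) (dW c.D 1))
      (fun _ => dW_real c.D 1) (fun _ => dW_ne c.D 1)).CompatibleSplitting)
  (hGR₂ : ∀ {L : CMField} {ι₁ : L →+* ℂ} (V : HermSpace3 L ι₁) (c : SeesawCtx L),
    (cmSplittingDatum (L : Type) (e₁) (frameD V) (frameD_real V) (frameD_ne V) (lineVec (L : Type) (dW' c.D 0))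
      (fun _ => dW'_real c.D 0) (fun _ => dW'_ne c.D 0)).CompatibleSplitting)
  (hGR₃ : ∀ {L : CMField} {ι₁ : L →+* ℂ} (V : HermSpace3 L ι₁) (c : SeesawCtx L),
    (cmSplittingDatum (L : Type) (e₁) (frameD V) (frameD_real V) (frameD_ne V) (lineVec (L : Type) (dW' c.D 1))
      (fun _ => dW'_real c.D 1) (fun _ => dW'_ne c.D 1)).CompatibleSplitting)
  (μ μ' : ∀ {L : CMField}, SeesawCtx L → Fin 4 → NumberField.InfinitePlace (L : Type) → ℤ)
  {L : CMField} {ι₁ : L →+* ℂ} (V : HermSpace3 L ι₁) (c : SeesawCtx L)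

/-- **slot 0 at the pin**: the `V`-character of the twisted slot-0 split is the same for every row-6 table. -/
theorem lineCharV_zero_pin_eq_of_mu :
    lineCharV_zero V c.D (hGR V c) (hGR₀ V c) (hGR₁ V c)
        (etaT₀ V c.D (EtaChi.η (@χVR @hGR @hGR₀ @hGR₁) (@χWR @hGR @hGR₀ @hGR₁ @μ) V c) (νR @hGR₁ V c)) =
      lineCharV_zero V c.D (hGR V c) (hGR₀ V c) (hGR₁ V c)
        (etaT₀ V c.D (EtaChi.η (@χVR @hGR @hGR₀ @hGR₁) (@χWR @hGR @hGR₀ @hGR₁ @μ') V c) (νR @hGR₁ V c)) :=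
  lineCharV_zero_etaT_eq_of_chiW V c (hGR V c) (hGR₀ V c) (hGR₁ V c) _ _ _ _

/-- **slot 1 at the pin**. -/
theorem lineCharV_one_pin_eq_of_mu :
    lineCharV_one V c.D (hGR V c) (hGR₀ V c) (hGR₁ V c)
        (etaT₁ V c.D (EtaChi.η (@χVR @hGR @hGR₀ @hGR₁) (@χWR @hGR @hGR₀ @hGR₁ @μ) V c) (νR @hGR₁ V c)) =
      lineCharV_one V c.D (hGR V c) (hGR₀ V c) (hGR₁ V c)
        (etaT₁ V c.D (EtaChi.η (@χVR @hGR @hGR₀ @hGR₁) (@χWR @hGR @hGR₀ @hGR₁ @μ') V c) (νR @hGR₁ V c)) :=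
  lineCharV_one_etaT_eq_of_chiW V c (hGR V c) (hGR₀ V c) (hGR₁ V c) _ _ _ _

/-- **slot 2 at the pin**. -/
theorem lineCharV_two_pin_eq_of_mu :
    lineCharV_two V c.D (hGR V c) (hGR₂ V c) (hGR₃ V c)
        (etaT₂ V c.D (EtaChi.η (@χVR @hGR @hGR₀ @hGR₁) (@χWR @hGR @hGR₀ @hGR₁ @μ) V c) (ν'R @hGR₃ V c)) =
      lineCharV_two V c.D (hGR V c) (hGR₂ V c) (hGR₃ V c)
        (etaT₂ V c.D (EtaChi.η (@χVR @hGR @hGR₀ @hGR₁) (@χWR @hGR @hGR₀ @hGR₁ @μ') V c) (ν'R @hGR₃ V c)) :=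
  lineCharV_two_etaT_eq_of_chiW V c (hGR V c) (hGR₂ V c) (hGR₃ V c) _ _ _ _

/-- **slot 3 at the pin**. -/
theorem lineCharV_three_pin_eq_of_mu :
    lineCharV_three V c.D (hGR V c) (hGR₂ V c) (hGR₃ V c)
        (etaT₃ V c.D (EtaChi.η (@χVR @hGR @hGR₀ @hGR₁) (@χWR @hGR @hGR₀ @hGR₁ @μ) V c) (ν'R @hGR₃ V c)) =
      lineCharV_three V c.D (hGR V c) (hGR₂ V c) (hGR₃ V c)
        (etaT₃ V c.D (EtaChi.η (@χVR @hGR @hGR₀ @hGR₁) (@χWR @hGR @hGR₀ @hGR₁ @μ') V c) (ν'R @hGR₃ V c)) :=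
  lineCharV_three_etaT_eq_of_chiW V c (hGR V c) (hGR₂ V c) (hGR₃ V c) _ _ _ _

/-- **sinst-1's slot-0 `V`-character at the pin** (the `V`-part of `bigCharZero`): the same for every row-6 table. -/
theorem adelicCharZero_pin_eq_of_mu :
    ThetaAdelicSide.adelicCharZero V c (hGR V c) (hGR₀ V c) (hGR₁ V c)
        (EtaChi.η (@χVR @hGR @hGR₀ @hGR₁) (@χWR @hGR @hGR₀ @hGR₁ @μ) V c) =
      ThetaAdelicSide.adelicCharZero V c (hGR V c) (hGR₀ V c) (hGR₁ V c)
        (EtaChi.η (@χVR @hGR @hGR₀ @hGR₁) (@χWR @hGR @hGR₀ @hGR₁ @μ') V c) :=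
  adelicCharZero_eq_of_chiW V c (hGR V c) (hGR₀ V c) (hGR₁ V c) _ _ _

end HodgeCM.Model.SInstance

end
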